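import Summits.AtomisticToContinuum.Crystallization.Theorems.HolmgrenBoyleLindGroundStatesChargeFLCEquilibriumToChargePeriodic
import Summits.AtomisticToContinuum.Crystallization.Theorems.HolmgrenBoyleLindFLCEquilibriumPeriodicIffUC
import Summits.AtomisticToContinuum.Crystallization.Theorems.HolmgrenBoyleLindAssembly
import Summits.AtomisticToContinuum.Crystallization.Theorems.HolmgrenBoyleLindFiniteRigidity

/-!
# Under the route's other crux `HalfSpaceUniqueContinuation`, the crux
# `GroundStatesChargeFLCEquilibrium` (stmt-AtomisticToContinuum-6076) IS the shared hinge
# `GroundStatesChargePeriodic` (stmt-AtomisticToContinuum-2911)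

Plan evidence (D-0014) in kernel-checked form. Route `HolmgrenBoyleLind` has two open cruxes, UC
(`HalfSpaceUniqueContinuation`, 6075) and LIM (`GroundStatesChargeFLCEquilibrium`, 6076); its third
crux HSR (`HalfSpaceRigidityPeriodic`, 6077) is proved. The landed glue gives
`FLCEquilibriumPeriodic ↔ HalfSpaceUniqueContinuation` (`flcEquilibriumPeriodic_iff_uc`, using the
proved HSR) and `FLCEquilibriumPeriodic → (LIM ↔ GroundStatesChargePeriodic)`
(`groundStatesChargeFLCEquilibrium_iff_groundStatesChargePeriodic`, p154082 with p145894). Hence: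

* `groundStatesChargeFLCEquilibrium_iff_groundStatesChargePeriodic_of_uc :
  HalfSpaceUniqueContinuation → (GroundStatesChargeFLCEquilibrium ↔ GroundStatesChargePeriodic)` —
  granted the route's own crux UC, LIM is EQUIVALENT to the hinge 2911 shared by eleven routes: LIM
  is not an independent load-bearing leaf of this route (an FLC-but-aperiodic charging mechanism
  would have to exploit exactly the `¬ UC` freedom the route bets against);
* `crystallization_of_uc_of_groundStatesChargePeriodic :
  HalfSpaceUniqueContinuation → GroundStatesChargePeriodic → Crystallization` and
  `crystallization_of_uc_of_lim : HalfSpaceUniqueContinuation → GroundStatesChargeFLCEquilibrium →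
  Crystallization` — the route is down to exactly {UC, hinge}: every other hypothesis of its
  deciding theorem `closes` is discharged by a PROVED item (HSR 6077, CrysEnergyLimit 0626,
  ChargedPeriodicIsOptimal 2913, ChargedPatternCrystallizes 2916, FiniteRigidity 6078,
  Assembly 6080) or derived (FLCEquilibriumPeriodic 6079 from UC, the hinge 2911 from LIM + 6079).

All `[folklore]` glue; CONDITIONAL on UC (open); nothing here closes an item.
-/

namespace Summit.AtomisticToContinuum.Crystallization.Theorems.HolmgrenBoyleLindGroundStatesChargeFLCEquilibrium

open Summit.AtomisticToContinuum.Crystallization.Theses.HolmgrenBoyleLind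

/-- **Granted UC, the crux LIM is the hinge 2911.** `HalfSpaceUniqueContinuation` gives
`FLCEquilibriumPeriodic` (`flcEquilibriumPeriodic_of_uc`, via the proved `HalfSpaceRigidityPeriodic`),
under which `GroundStatesChargeFLCEquilibrium ↔ GroundStatesChargePeriodic`
(`groundStatesChargeFLCEquilibrium_iff_groundStatesChargePeriodic`). [folklore] -/
theorem groundStatesChargeFLCEquilibrium_iff_groundStatesChargePeriodic_of_uc
    (hUC : HalfSpaceUniqueContinuation) :
    GroundStatesChargeFLCEquilibrium ↔ GroundStatesChargePeriodic :=
  groundStatesChargeFLCEquilibrium_iff_groundStatesChargePeriodic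
    (Summit.AtomisticToContinuum.Crystallization.Theorems.flcEquilibriumPeriodic_of_uc hUC)

/-- **The route is down to {UC, hinge}.** `HalfSpaceUniqueContinuation` and the hinge
`GroundStatesChargePeriodic` give the sub-problem `Crystallization`: feed the route's deciding theorem
`closes` with UC, LIM (from the hinge, p145894), the PROVED items HSR / CrysEnergyLimit /
ChargedPeriodicIsOptimal / ChargedPatternCrystallizes / FiniteRigidity / Assembly, and
`FLCEquilibriumPeriodic` (from UC). [folklore] -/
theorem crystallization_of_uc_of_groundStatesChargePeriodic
    (hUC : HalfSpaceUniqueContinuation) (hGCP : GroundStatesChargePeriodic) :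
    _root_.Crystallization :=
  closes hUC (groundStatesChargeFLCEquilibrium_of_groundStatesChargePeriodic hGCP)
    Summit.AtomisticToContinuum.Crystallization.Theorems.holmgrenBoyleLind_halfSpaceRigidityPeriodic_proof
    Summit.AtomisticToContinuum.Crystallization.Theorems.crysEnergyLimit_proof hGCP
    Summit.AtomisticToContinuum.Crystallization.Theorems.chargedPeriodicIsOptimal_proof
    Summit.AtomisticToContinuum.Crystallization.Theorems.chargedPatternCrystallizes_proof
    Summit.AtomisticToContinuum.Crystallization.Theorems.HolmgrenBoyleLind.finiteRigidity_proof
    (Summit.AtomisticToContinuum.Crystallization.Theorems.flcEquilibriumPeriodic_of_uc hUC)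
    Summit.AtomisticToContinuum.Crystallization.Theorems.holmgrenBoyleLind_assembly_proof

/-- **The route is down to its two open cruxes {UC, LIM}.** `HalfSpaceUniqueContinuation` and
`GroundStatesChargeFLCEquilibrium` give `Crystallization` (LIM ⇒ hinge under UC, then
`crystallization_of_uc_of_groundStatesChargePeriodic`). [folklore] -/
theorem crystallization_of_uc_of_lim : Summit.AtomisticToContinuum.Crystallization.Theses.HolmgrenBoyleLind.HalfSpaceUniqueContinuation → Summit.AtomisticToContinuum.Crystallization.Theses.HolmgrenBoyleLind.GroundStatesChargeFLCEquilibrium → Crystallization :=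
  fun hUC hLIM => crystallization_of_uc_of_groundStatesChargePeriodic hUC
    ((groundStatesChargeFLCEquilibrium_iff_groundStatesChargePeriodic_of_uc hUC).1 hLIM)

end Summit.AtomisticToContinuum.Crystallization.Theorems.HolmgrenBoyleLindGroundStatesChargeFLCEquilibrium
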